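import Summits.Ventures.CertifiedManyBodySolver.Rows.CorrWindowCertKernelChainQuotAdjFast
import Summits.Ventures.CertifiedManyBodySolver.Rows.CorrWindowBoxGeometry
import HarnessLib

/-!
# Fast chain step, part 2: the whole normal-order engine with parity bits, and closed-form ℕ letter maps of a box geometry

(i) `wordToPolyS` = CQC's `wordToPoly` with `Bool` parities instead of `ℚ` products (`wordToPolyS_eq`, contractions included),
`normalizeS = normalize`; (ii) for `D = boxQuot r R vmax` (`Rows/CorrWindowBoxGeometry.lean`) the letter push `boxPush r R` and the
licensed moves `gq D γ v` computed by all-ℕ arithmetic on offset coordinates (`pushN_eq`, `gqN_eq` — the latter on licensed `(γ, v)`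
once `r + vmax ≤ R`). Consumed by `Rows/CorrWindowCertKernelChainQuotAdjFastBox.lean`.

HONEST FRAMING (xx1): Lean plumbing towards «tier P» — a PROOF-TERM-only speed-up of the kernel replay of chain steps; every
`step_s` statement, every accumulator literal, every census/EQUAL artefact, `ChainQAOK`/`StepsQA`/Assembly/closer stays byte-identical.
Nothing of record moves; no certificate is evaluated here; no claim node is discharged; CONTROL/CALIBRATION context; silent on the
presence of superconductivity; not a `T_c` or phase sentence; nothing about any material; no summit statement is proved by this file.
Cell `hubbard-obs` × `hubbard-downfold` (D-0154 (1)(C) La214), seat hubbard-cov-la214-box-2 g5 (`prover-hubbard-cov-la214-box-2-g5-0`),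
lever (L7) of captain ruling R-g4-12 (obs-p2 GO 2026-08-29T02:25:48Z), zero compute.

References: C. Jansson, D. Chaykin, C. Keil, SIAM J. Numer. Anal. 46 (2008) 180 [JanssonChaykinKeil2008]; X. Han, arXiv:2006.06002 §3
[Han2020Bootstrap]; O. Bratteli, D. W. Robinson, *Operator Algebras and Quantum Statistical Mechanics 2* §5.2.2 [BratteliRobinsonII1997].
-/

namespace Summit.Ventures.CertifiedManyBodySolver

namespace CARPolyWindow

open Summit.Ventures.CertifiedQuantumChemistry Summit.Ventures.CertifiedQuantumChemistry.CARPoly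
open Literature.MathematicalPhysics.QuantumLattice Literature.MathematicalPhysics.QuantumLattice.HubbardWave0

/-! ## §1 The engine with parity bits -/

section SignedEngine

variable {α : Type*} [LinearOrder α]

/-! ### The whole engine with `Bool` signs (contractions included) -/

/-- `prependCre` with a parity bit. [cite: BratteliRobinsonII1997, §5.2.2] -/
def prependCreS (x : α) : List α → List α → List (CARPoly.Mono α × Bool)
  | [], A => [(([x], A), false)]
  | c :: C, A =>
    if x < c then [((x :: c :: C, A), false)]
    else if x = c then []
    else (prependCreS x C A).map fun ms => ((c :: ms.1.1, ms.1.2), !ms.2)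

/-- `insAnn` with a parity bit. [cite: BratteliRobinsonII1997, §5.2.2] -/
def insAnnS (x : α) : List α → List (CARPoly.Mono α × Bool)
  | [] => [(([], [x]), false)]
  | a :: A =>
    if x < a then [(([], x :: a :: A), false)]
    else if x = a then []
    else (insAnnS x A).map fun ms => (([], a :: ms.1.2), !ms.2)

/-- `prependAnn` with a parity bit (contraction terms carry the current parity). [cite: BratteliRobinsonII1997, §5.2.2] -/
def prependAnnS (x : α) : List α → List α → List (CARPoly.Mono α × Bool)
  | [], A => insAnnS x A
  | c :: C, A =>
    (if x = c then [((C, A), false)] else []) ++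
      (prependAnnS x C A).map fun ms => ((c :: ms.1.1, ms.1.2), !ms.2)

/-- `prependLetter` with a parity bit. [folklore] -/
def prependLetterS (l : α × Bool) (m : CARPoly.Mono α) : List (CARPoly.Mono α × Bool) :=
  if l.2 then prependCreS l.1 m.1 m.2 else prependAnnS l.1 m.1 m.2

/-- `prependLetterPoly` with parity bits. [folklore] -/
def prependLetterPolyS (l : α × Bool) (P : List (CARPoly.Mono α × Bool)) : List (CARPoly.Mono α × Bool) :=
  P.flatMap fun ms => (prependLetterS l ms.1).map fun ms' => (ms'.1, xor ms.2 ms'.2)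

/-- **`wordToPoly` with parity bits** (no rational arithmetic at all). [cite: BratteliRobinsonII1997, §5.2.2] -/
def wordToPolyS : List (α × Bool) → List (CARPoly.Mono α × Bool)
  | [] => [(CARPoly.Mono.unit, false)]
  | l :: w => prependLetterPolyS l (wordToPolyS w)

/-- Reading a parity bit as a rational sign. [folklore] -/
def toQ (ms : CARPoly.Mono α × Bool) : CARPoly.Mono α × ℚ := (ms.1, sgnQ ms.2)

/-- `prependCre` through parity bits. [folklore] -/
theorem prependCreS_eq (x : α) (A : List α) : ∀ C : List α, CARPoly.prependCre x C A = (prependCreS x C A).map toQ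
  | [] => by simp [CARPoly.prependCre, prependCreS, toQ, sgnQ]
  | c :: C => by
    rw [CARPoly.prependCre, prependCreS]
    by_cases h1 : x < c
    · simp [h1, toQ, sgnQ]
    · by_cases h2 : x = c
      · simp [h2]
      · simp only [h1, h2, if_false, prependCreS_eq x A C, List.map_map]
        congr 1
        funext ms
        simp [toQ, sgnQ_not]

/-- `insAnn` through parity bits. [folklore] -/
theorem insAnnS_eq (x : α) : ∀ A : List α, CARPoly.insAnn x A = (insAnnS x A).map toQ
  | [] => by simp [CARPoly.insAnn, insAnnS, toQ, sgnQ]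
  | a :: A => by
    rw [CARPoly.insAnn, insAnnS]
    by_cases h1 : x < a
    · simp [h1, toQ, sgnQ]
    · by_cases h2 : x = a
      · simp [h2]
      · simp only [h1, h2, if_false, insAnnS_eq x A, List.map_map]
        congr 1
        funext ms
        simp [toQ, sgnQ_not]

/-- `prependAnn` through parity bits. [folklore] -/
theorem prependAnnS_eq (x : α) (A : List α) : ∀ C : List α, CARPoly.prependAnn x C A = (prependAnnS x C A).map toQ
  | [] => by rw [CARPoly.prependAnn, prependAnnS, insAnnS_eq]
  | c :: C => by
    rw [CARPoly.prependAnn, prependAnnS, List.map_append, prependAnnS_eq x A C, List.map_map, List.map_map]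
    congr 1
    · by_cases h : x = c <;> simp [h, toQ, sgnQ]
    · simp only [Function.comp_def, toQ, sgnQ_not]

/-- `prependLetter` through parity bits. [folklore] -/
theorem prependLetterS_eq (l : α × Bool) (m : CARPoly.Mono α) : CARPoly.prependLetter l m = (prependLetterS l m).map toQ := by
  unfold CARPoly.prependLetter prependLetterS
  split_ifs
  · exact prependCreS_eq l.1 m.2 m.1
  · exact prependAnnS_eq l.1 m.2 m.1

/-- `prependLetterPoly` through parity bits. [folklore] -/
theorem prependLetterPolyS_eq (l : α × Bool) (P : List (CARPoly.Mono α × Bool)) :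
    CARPoly.prependLetterPoly l (P.map toQ) = (prependLetterPolyS l P).map toQ := by
  induction P with
  | nil => rfl
  | cons ms P ih =>
    simp only [CARPoly.prependLetterPoly, List.map_cons, List.flatMap_cons, prependLetterPolyS, List.map_append] at ih ⊢
    rw [ih, prependLetterS_eq, List.map_map, List.map_map]
    congr 1
    · congr 1
      funext ms'
      simp [toQ, sgnQ_xor]

/-- **The engine with parity bits IS the engine.** [cite: BratteliRobinsonII1997, §5.2.2] -/
theorem wordToPolyS_eq : ∀ w : List (α × Bool), CARPoly.wordToPoly w = (wordToPolyS w).map toQ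
  | [] => by simp [CARPoly.wordToPoly, wordToPolyS, toQ, sgnQ]
  | l :: w => by rw [CARPoly.wordToPoly, wordToPolyS, wordToPolyS_eq w, prependLetterPolyS_eq]

/-- `termsToPoly` through the parity engine: one conditional negation per monomial instead of a product. [folklore] -/
def termsToPolyS (T : List (List (α × Bool) × ℚ)) : CARPoly.Poly α :=
  T.flatMap fun wc => (wordToPolyS wc.1).map fun ms => (ms.1, if ms.2 then -wc.2 else wc.2)

/-- `termsToPoly` through the parity engine. [folklore] -/
theorem termsToPolyS_eq (T : List (List (α × Bool) × ℚ)) : CARPoly.termsToPoly T = termsToPolyS T := by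
  induction T with
  | nil => rfl
  | cons wc T ih =>
    simp only [CARPoly.termsToPoly, List.flatMap_cons, termsToPolyS] at ih ⊢
    rw [ih, wordToPolyS_eq, List.map_map]
    congr 1
    congr 1
    funext ms
    rcases ms with ⟨m, s⟩
    cases s <;> simp [toQ, sgnQ]

/-- `normalize` through the parity engine. [folklore] -/
def normalizeS (enc : α → ℕ) (B : ℕ) (T : List (List (α × Bool) × ℚ)) : CARPoly.Poly α := CARPoly.collect enc B (termsToPolyS T)

/-- `normalizeS` IS `normalize`. [folklore] -/
theorem normalizeS_eq (enc : α → ℕ) (B : ℕ) (T : List (List (α × Bool) × ℚ)) : normalizeS enc B T = CARPoly.normalize enc B T := by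
  rw [normalizeS, CARPoly.normalize, termsToPolyS_eq]

end SignedEngine

/-! ## §2 Closed-form ℕ letter maps of `boxQuot r R vmax` -/

section BoxMaps

open BoxGeom Literature.Probability.LatticeModels

/-- The `D₄` action by code on OFFSET box coordinates `(X, Y) = (x + R, y + R)` (centre `R`, so `−x ↦ 2R − X`):
codes `0–3` = `r 0 … r 3` (`(x,y) ↦ (−y,x)` iterated), `4–7` = `sr 0 … sr 3` (then `(x,y) ↦ (x,−y)`). [folklore] -/
def d4N (R2 : ℕ) (c : ℕ) (X Y : ℕ) : ℕ × ℕ :=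
  match c with
  | 0 => (X, Y)
  | 1 => (R2 - Y, X)
  | 2 => (R2 - X, R2 - Y)
  | 3 => (Y, R2 - X)
  | 4 => (X, R2 - Y)
  | 5 => (R2 - Y, R2 - X)
  | 6 => (R2 - X, Y)
  | _ => (Y, X)

/-- The index of OFFSET coordinates (junk-total, same arithmetic as `boxIx`). [folklore] -/
def boxIxN (R X Y : ℕ) : Fin (boxN R) :=
  ⟨(X % side R) * side R + Y % side R, by
    have hs := side_pos R
    have hx : X % side R < side R := Nat.mod_lt _ hs
    have hy : Y % side R < side R := Nat.mod_lt _ hs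
    calc X % side R * side R + Y % side R
        < X % side R * side R + side R := by omega
      _ = (X % side R + 1) * side R := by ring
      _ ≤ side R * side R := Nat.mul_le_mul_right _ hx⟩

/-- `boxIx` reads the offset coordinates. [folklore] -/
theorem boxIx_eq_boxIxN (R : ℕ) (w : Site 2) : boxIx R w = boxIxN R (w 0 + R).toNat (w 1 + R).toNat := rfl

/-- **Closed-form push** inner box `r` → outer box `R` (all-ℕ arithmetic). [folklore] -/
def pushN (r R : ℕ) (b : Orb (Fin (boxN r))) : Orb (Fin (boxN R)) :=
  orb (boxIxN R ((ofLex b).1.val / side r + (R - r)) ((ofLex b).1.val % side r + (R - r))) (ofLex b).2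

/-- **Closed-form move** `x ↦ γ·x + v` on an inner letter, with `w = v + vmax` as naturals (all-ℕ arithmetic). [cite: Han2020Bootstrap, §3] -/
def gqN (r R vmax : ℕ) (c : Fin 8) (w1 w2 : ℕ) (b : Orb (Fin (boxN r))) : Orb (Fin (boxN R)) :=
  let p := d4N (2 * R) c.val ((ofLex b).1.val / side r + (R - r)) ((ofLex b).1.val % side r + (R - r))
  orb (boxIxN R (p.1 + w1 - vmax) (p.2 + w2 - vmax)) (ofLex b).2

/-- The row coordinate of an index is at most `2r`. [folklore] -/
theorem div_side_le (r : ℕ) (j : Fin (boxN r)) : j.val / side r ≤ 2 * r := by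
  have hj : j.val < side r * side r := j.isLt
  have h : j.val / side r < side r := Nat.div_lt_of_lt_mul hj
  have hs : side r = 2 * r + 1 := rfl
  omega

/-- The column coordinate of an index is at most `2r`. [folklore] -/
theorem mod_side_le (r : ℕ) (j : Fin (boxN r)) : j.val % side r ≤ 2 * r := by
  have h : j.val % side r < side r := Nat.mod_lt _ (side_pos r)
  have hs : side r = 2 * r + 1 := rfl
  omega

/-- The push agrees with `boxPush` once `r ≤ R`. [folklore] -/
theorem pushN_eq {r R : ℕ} (h : r ≤ R) (b : Orb (Fin (boxN r))) : pushN r R b = boxPush r R b := by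
  unfold pushN boxPush
  rw [boxIx_eq_boxIxN]
  have ha := div_side_le r (ofLex b).1
  have hb := mod_side_le r (ofLex b).1
  have e0 : (boxXs r (ofLex b).1 0 + R).toNat = (ofLex b).1.val / side r + (R - r) := by
    simp only [boxXs, Matrix.cons_val_zero]
    generalize (ofLex b).1.val / side r = q
    omega
  have e1 : (boxXs r (ofLex b).1 1 + R).toNat = (ofLex b).1.val % side r + (R - r) := by
    simp only [boxXs, Matrix.cons_val_one, Matrix.cons_val_zero]
    generalize (ofLex b).1.val % side r = q
    omega
  rw [e0, e1]

/-- The integer form of the coded `D₄` action: components of `d4Vec (d4OfCode c) e` (double negations kept as the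
definition unfolds, so that each case is `rfl`). [folklore] -/
theorem d4Vec_code (c : Fin 8) (e : Site 2) :
    (d4Vec (d4OfCode c) e 0, d4Vec (d4OfCode c) e 1) =
      (match c.val with
        | 0 => (e 0, e 1) | 1 => (-e 1, e 0) | 2 => (-e 0, -e 1) | 3 => (-(-e 1), -e 0)
        | 4 => (e 0, -e 1) | 5 => (-e 1, -e 0) | 6 => (-e 0, -(-e 1)) | _ => (-(-e 1), -(-e 0))) := by
  fin_cases c <;> rfl

/-- **The closed-form move agrees with `gq (boxQuot r R vmax)` on every licensed `(γ, v)` once `r + vmax ≤ R`.**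
[cite: Han2020Bootstrap, §3] -/
theorem gqN_eq {r R vmax : ℕ} (h : r + vmax ≤ R) (c : Fin 8) (v : ℤ × ℤ) (hok : boxOk vmax c v = true)
    (b : Orb (Fin (boxN r))) :
    gqN r R vmax c (v.1 + vmax).toNat (v.2 + vmax).toNat b = gq (boxQuot r R vmax) (d4OfCode c) (siteOfPair v) b := by
  have hv : -(vmax : ℤ) ≤ v.1 ∧ v.1 ≤ vmax ∧ -(vmax : ℤ) ≤ v.2 ∧ v.2 ≤ vmax := of_decide_eq_true hok
  have ha := div_side_le r (ofLex b).1
  have hb := mod_side_le r (ofLex b).1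
  unfold gqN gq
  show orb _ _ = orb (boxIx R (d4Vec (d4OfCode c) (boxXs r (ofLex b).1) + siteOfPair v)) (ofLex b).2
  rw [boxIx_eq_boxIxN]
  simp only [Pi.add_apply, siteOfPair, Matrix.cons_val_zero, Matrix.cons_val_one]
  have hc := d4Vec_code c (boxXs r (ofLex b).1)
  have e0 : boxXs r (ofLex b).1 0 = (((ofLex b).1.val / side r : ℕ) : ℤ) - r := by
    simp [boxXs]
  have e1 : boxXs r (ofLex b).1 1 = (((ofLex b).1.val % side r : ℕ) : ℤ) - r := by
    simp [boxXs]
  rw [e0, e1] at hc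
  clear e0 e1
  generalize (ofLex b).1.val / side r = A at hc ha ⊢
  generalize (ofLex b).1.val % side r = Bv at hc hb ⊢
  generalize d4Vec (d4OfCode c) (boxXs r (ofLex b).1) 0 = W0 at hc ⊢
  generalize d4Vec (d4OfCode c) (boxXs r (ofLex b).1) 1 = W1 at hc ⊢
  rcases c with ⟨k, hk⟩
  have hk8 : k < 8 := hk
  -- eight codes
  interval_cases k <;>
  · simp only [Prod.mk.injEq] at hc
    obtain ⟨h0, h1⟩ := hc
    subst h0 h1
    simp only [d4N]
    congr 2 <;> omega

end BoxMaps

end CARPolyWindow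

end Summit.Ventures.CertifiedManyBodySolver
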